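import Summits.FinalStateConjecture.FinalStateConjecture.Statement
import Summits.FinalStateConjecture.FinalStateConjecture.Theorems.UniversalWitnessFamily.Negative.MinkowskiSettled
import Summits.FinalStateConjecture.FinalStateConjecture.Theorems.PhotonSphereChannelsChannelsResolveTameDevelopmentsRMinkowskiMaximal
import HarnessLib

/-!
# Crux `DriftCapture` (stmt-FinalStateConjecture-17391), stub `stub_flatLateChartOfTracking`:
# the anchored flat late chart IS the honest `N = 0` decomposition (converse packaging), and the
# stub's conclusion holds at the model point

The conclusion of the registered stub `stub_flatLateChartOfTracking` (ASSEMBLE at `N = 0`) is an anchored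
flat late chart with five clauses (`U₁ ⊇ {x⁰ > τ₁}`; late chart into `J⁺(ι X) ∩ I⁻(Φ{x⁰ > τ₁})`;
`C²`-deviation `→ 0`; uncharted part below every slab `τ ≥ τ₁`; `Φ_* ∂₀` eventually future-directed). The
landed `globalGauge_zero_of_flatLateChart` (p148929) packages such a chart INTO an honest, exhaustive,
future-oriented `0`-hole `C²` final-state decomposition `d` of `O = exteriorOf 𝒟 d.charted`. This file
proves the CONVERSE (`flatLateChart_of_zeroDecomposition`): the flat chart of any such decomposition with
`d.N = 0` is an anchored flat late chart with the five clauses (`τ₁ := d.τ₀`; with no hole the certified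
late regions and slabs are the flat ones, and the clause at `τ = τ₀` is the structure's covering clause).
So the `N = 0` target of `DriftCapture` is EQUIVALENT to the summit's settling clause at `N = 0` minus
`RaysStayInClosure` — and in particular it holds wherever an honest `N = 0` decomposition is in the tree:
at the model point, the Minkowski development of the trivial datum with the identity flat chart
(`flatLateChart_conclusion_minkowski`, from the landed `UniversalWitnessFamily.Negative.minkowskiDecomp`,
`minkowskiExterior_eq_exteriorOf`, `hasExhaustiveCharts_minkowskiDecomp` and
`ChannelsResolveTameDevelopmentsR.TrivialDatum.isFutureOriented_minkowskiDecomp`). Anti-vacuity audit of the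
stub: its conclusion is satisfiable in the stub's exact typing at a certified vacuum Cauchy development
of an admissible datum.

Mathlib + the Statement + landed `Theorems` only; no definitions, no named facts, no `sorry`.

References: Christodoulou–Klainerman 1993, Thm. 1.0.2 (Minkowski space is its own final state);
Dafermos–Luk arXiv:1710.01722, Conjecture 1 (`N = 0` shape of the settling clause).
-/

-- the doubled `FinalStateConjecture.FinalStateConjecture` path component trips dupNamespace
set_option linter.dupNamespace false

noncomputable section

namespace Summit.FinalStateConjecture.FinalStateConjecture.Theorems.RenormalisedDrift.DriftCapture

open Set Filter Topology TopologicalSpace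
open scoped Manifold ContDiff ENNReal
open Literature.Geometry.Lorentzian

/-- **An honest exhaustive future-oriented `0`-hole decomposition is an anchored flat late chart**
(converse of the packaging `globalGauge_zero_of_flatLateChart`). For a Cauchy development `𝒟`, a `C²`
final-state decomposition `d` of `O` with NO hole, `O = exteriorOf 𝒟 d.charted`, `HasExhaustiveCharts d` and
`IsFutureOriented d`: the flat chart `d.flatChart` on `d.flatDomain ⊇ {x⁰ > d.τ₀}` is a late chart into
`J⁺(ι X) ∩ I⁻(flatChart{x⁰ > τ₀})` (`d.charted` is the radiation zone), its `C²` deviation tends to `0`,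
its uncharted part beyond every `τ ≥ τ₀` lies below the flat slab at `τ` (exhaustion for `τ > τ₀`, the
structure's covering clause at `τ = τ₀`; the certified near-zone pieces are empty), and `∂₀` is eventually
future-directed (third clause of `IsFutureOriented`). [cite: DafermosLuk2017, Conjecture 1] -/
theorem flatLateChart_of_zeroDecomposition {X : Type} [TopologicalSpace X] [ChartedSpace E3 X]
    [IsManifold (𝓡 3) ∞ X] [ConnectedSpace X] {D : InitialDataSet (𝓡 3) X} (𝒟 : CauchyDevelopment D)
    (O : Set 𝒟.carrier) (d : FinalStateDecomposition 𝒟.toSpacetime O 2) (hN : d.N = 0)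
    (hO : O = Summit.FinalStateConjecture.exteriorOf 𝒟 d.charted)
    (hexh : Summit.FinalStateConjecture.HasExhaustiveCharts d)
    (hfut : Summit.FinalStateConjecture.IsFutureOriented d) :
    ∃ (τ₁ : ℝ) (U₁ : Opens E4) (Φ : U₁ → 𝒟.carrier),
      {x : E4 | τ₁ < x 0} ⊆ (U₁ : Set E4) ∧
      𝒟.toSpacetime.IsLateChart (Minkowski.backgroundOn U₁)
        (Summit.FinalStateConjecture.exteriorOf 𝒟 (Φ '' (Minkowski.backgroundOn U₁).lateRegion τ₁)) τ₁ Φ ∧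
      Tendsto (fun τ ↦ 𝒟.toSpacetime.deviationCk (Minkowski.backgroundOn U₁) Φ 2 τ) atTop (𝓝 0) ∧
      (∀ τ : ℝ, τ₁ ≤ τ →
        Summit.FinalStateConjecture.exteriorOf 𝒟 (Φ '' (Minkowski.backgroundOn U₁).lateRegion τ₁) \
            Φ '' (Minkowski.backgroundOn U₁).lateRegion τ ⊆
          𝒟.metric.causalPast 𝒟.timeOrientation (Φ '' (Minkowski.backgroundOn U₁).timeSlab τ)) ∧
      ∀ᶠ τ in atTop, ∀ x ∈ (Minkowski.backgroundOn U₁).timeSlab τ,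
        𝒟.timeOrientation.IsFutureDirected (mfderiv 𝓘(ℝ, E4) (𝓡 4) Φ x (E4.basisVector 0)) := by
  haveI : IsEmpty (Fin d.N) := hN ▸ Fin.isEmpty'
  -- with no hole, the charted late region is the radiation zone `flatChart{x⁰ > τ₀}`
  have hch : d.charted = d.flatChart '' (Minkowski.backgroundOn d.flatDomain).lateRegion d.τ₀ := by
    rw [FinalStateDecomposition.charted, iUnion_of_empty, union_empty]
    rfl
  have hE : Summit.FinalStateConjecture.exteriorOf 𝒟
      (d.flatChart '' (Minkowski.backgroundOn d.flatDomain).lateRegion d.τ₀) = O := by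
    rw [← hch]
    exact hO.symm
  obtain ⟨R, -, -, hcov⟩ := hexh
  refine ⟨d.τ₀, d.flatDomain, d.flatChart, fun x hx ↦ d.lateRegion_subset_flatDomain_of_N_eq_zero hN hx,
    ?_, d.tendsto_deviationCk_flat, fun τ hτ ↦ ?_, hfut.2.2⟩
  · rw [hE]
    exact d.isLateChart_flat
  · rcases hτ.eq_or_lt with rfl | hlt
    · -- at `τ₀` itself: the structure's covering clause, no hole
      intro p hp
      have hpO : p ∈ O := by rw [← hE]; exact hp.1
      exact d.diff_radiationZone_subset_of_N_eq_zero hN ⟨hpO, hp.2⟩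
    · -- beyond `τ₀`: exhaustion, the certified pieces being the flat ones
      have h := hcov τ hlt
      simp only [Summit.FinalStateConjecture.certifiedLate, Summit.FinalStateConjecture.certifiedSlab,
        iUnion_of_empty, union_empty] at h
      intro p hp
      have hpO : p ∈ O := by rw [← hE]; exact hp.1
      exact h ⟨hpO, hp.2⟩

/-- **The stub's conclusion holds at the model point.** In the Minkowski vacuum Cauchy development of the
trivial datum `(ℝ³, δ, 0)` (an admissible datum; maximal granted Choquet-Bruhat–Geroch) there is an anchored
flat late chart with the five clauses of `stub_flatLateChartOfTracking`'s conclusion, verbatim in its typing: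
the identity flat chart on all of `E4` after `τ₁ = 0`, i.e. the flat chart of the landed honest `N = 0`
decomposition `minkowskiDecomp` of `{x⁰ ≥ 0} = exteriorOf`, through `flatLateChart_of_zeroDecomposition`.
Anti-vacuity certificate: no clause of the stub's conclusion is a typed defect.
[cite: ChristodoulouKlainerman1993, Thm. 1.0.2] -/
theorem flatLateChart_conclusion_minkowski : ∃ (τ₁ : ℝ) (U₁ : TopologicalSpace.Opens E4) (Φ : U₁ → Minkowski.vacuumCauchyDevelopment.carrier), {x : E4 | τ₁ < x 0} ⊆ (U₁ : Set E4) ∧ Minkowski.vacuumCauchyDevelopment.toSpacetime.IsLateChart (Minkowski.backgroundOn U₁) (Summit.FinalStateConjecture.exteriorOf Minkowski.vacuumCauchyDevelopment.toCauchyDevelopment (Φ '' (Minkowski.backgroundOn U₁).lateRegion τ₁)) τ₁ Φ ∧ Tendsto (fun τ ↦ Minkowski.vacuumCauchyDevelopment.toSpacetime.deviationCk (Minkowski.backgroundOn U₁) Φ 2 τ) atTop (𝓝 0) ∧ (∀ τ : ℝ, τ₁ ≤ τ → Summit.FinalStateConjecture.exteriorOf Minkowski.vacuumCauchyDevelopment.toCauchyDevelopment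 (Φ '' (Minkowski.backgroundOn U₁).lateRegion τ₁) \ Φ '' (Minkowski.backgroundOn U₁).lateRegion τ ⊆ Minkowski.vacuumCauchyDevelopment.metric.causalPast Minkowski.vacuumCauchyDevelopment.timeOrientation (Φ '' (Minkowski.backgroundOn U₁).timeSlab τ)) ∧ ∀ᶠ τ in atTop, ∀ x ∈ (Minkowski.backgroundOn U₁).timeSlab τ, Minkowski.vacuumCauchyDevelopment.toSpacetime.timeOrientation.IsFutureDirected (mfderiv 𝓘(ℝ, E4) (𝓡 4) Φ x (E4.basisVector 0)) :=
  flatLateChart_of_zeroDecomposition Minkowski.vacuumCauchyDevelopment.toCauchyDevelopment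
    UniversalWitnessFamily.Negative.minkowskiExterior UniversalWitnessFamily.Negative.minkowskiDecomp rfl
    UniversalWitnessFamily.Negative.minkowskiExterior_eq_exteriorOf
    UniversalWitnessFamily.Negative.hasExhaustiveCharts_minkowskiDecomp
    ChannelsResolveTameDevelopmentsR.TrivialDatum.isFutureOriented_minkowskiDecomp

end Summit.FinalStateConjecture.FinalStateConjecture.Theorems.RenormalisedDrift.DriftCapture

end
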